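import Mathlib
import HarnessLib
import Summits.NavierStokesRegularity.NavierStokesRegularity.Theorems.CompletionRelayChainRelayFrontStepIgnitionWindowA
import Summits.NavierStokesRegularity.NavierStokesRegularity.Theorems.CompletionRelayChainRelayFrontStepIgnitionChain

/-!
# `CompletionRelayChain` — crux `RelayFrontStep` (24850), LINE `window_v2`, stub `stub_ignition` (Phase II):
  pointwise facts on the Phase-II window under the crude caps (part B: the front block)

`clock_x2_lower_int` (lower clock with the trigger integrated: `x₂(t) − x₂(a) ≥ (u(t)² − u(a)²)/(2M) − (ε′/M)∫ₐᵗu − ε₂(t−a)`)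
and `window_sqrtF12` (`√F₁₂ ≤ 9.49e-4` at a window time, two-pass slack bound). The front-block lemma `window_front`
built on them is in `…IgnitionWindowC`.

No definitions. HONEST FRAMING: MODEL lattice only (Tao 2016 §4 vocabulary); helper for one registered stub of an open
crux, no stub credit; nothing here is a statement about the Navier–Stokes equations.
-/

noncomputable section

-- the summit-side namespace repeats a component by design (D-0017)
set_option linter.dupNamespace false

open Set MeasureTheory intervalIntegral Literature.Analysis.FluidPDE Literature.Analysis.FluidPDE.TaoCascade
open Summit.NavierStokesRegularity.NavierStokesRegularity.Theorems
open Summit.NavierStokesRegularity.NavierStokesRegularity.Theorems.RelayFrontStep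
open Literature.NumberTheory.LFunctions.VdC.Num (sqrt_le_of_le_sq)

namespace Summit.NavierStokesRegularity.NavierStokesRegularity.Cruxes.RelayFrontStep.Window2

/-! ### Lower clock with the trigger integrated -/

/-- **Lower clock, integrated source**: on `[a,b] ⊆ [0,τ]`, if `0 ≤ u`, `u′ ≤ ΛMu + ε'` (`M > 0`, `ε' ≥ 0`) and
`x₂′ ≥ Λu² − ε₂`, then `x₂(a) + (u(t)² − u(a)²)/(2M) − (ε'/M)∫ₐᵗ u − ε₂(t − a) ≤ x₂(t)`. [folklore] -/
theorem clock_x2_lower_int {u x₂ : ℝ → ℝ} {τ a b Λ M ε' ε₂ : ℝ} (hu : ContDiffOn ℝ 1 u (Icc 0 τ))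
    (hx₂ : ContDiffOn ℝ 1 x₂ (Icc 0 τ)) (ha : 0 ≤ a) (hab : a ≤ b) (hb : b ≤ τ) (hM : 0 < M)
    (hpos : ∀ s ∈ Icc a b, 0 ≤ u s)
    (hu'up : ∀ s ∈ Icc a b, derivWithin u (Icc 0 τ) s ≤ Λ * M * u s + ε')
    (hx₂'lo : ∀ s ∈ Icc a b, Λ * u s ^ 2 - ε₂ ≤ derivWithin x₂ (Icc 0 τ) s) :
    ∀ t ∈ Icc a b, x₂ a + (u t ^ 2 - u a ^ 2) / (2 * M) - ε' / M * (∫ s in a..t, u s) - ε₂ * (t - a) ≤ x₂ t := by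
  have hsubI : Icc a b ⊆ Icc 0 τ := Icc_subset_Icc ha hb
  have huc : ContinuousOn u (Icc a b) := hu.continuousOn.mono hsubI
  -- primitive of u on [a,b]
  have hPderiv : ∀ t ∈ Ioo a b, HasDerivAt (fun t => ∫ s in a..t, u s) (u t) t := by
    intro t ht
    have hint : IntervalIntegrable u volume a t :=
      (huc.mono (by rw [uIcc_of_le ht.1.le]; exact Icc_subset_Icc_right ht.2.le)).intervalIntegrable
    have hmem : Icc a b ∈ nhds t := Icc_mem_nhds ht.1 ht.2
    exact intervalIntegral.integral_hasDerivAt_right hint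
      (ContinuousOn.stronglyMeasurableAtFilter isOpen_Ioo (huc.mono Ioo_subset_Icc_self) t ht) (huc.continuousAt hmem)
  have hPcont : ContinuousOn (fun t => ∫ s in a..t, u s) (Icc a b) := by
    have h := intervalIntegral.continuousOn_primitive_interval (μ := volume) (f := u) (a := a) (b := b)
      ((huc.integrableOn_Icc).mono_set (by rw [uIcc_of_le hab]))
    rwa [uIcc_of_le hab] at h
  -- z(t) := x₂ t − u t²/(2M) + (ε'/M) ∫_a^t u + ε₂ t is monotone on [a,b]
  set z : ℝ → ℝ := fun t => x₂ t - u t * u t / (2 * M) + ε' / M * (∫ s in a..t, u s) + ε₂ * t with hz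
  have hzc : ContinuousOn z (Icc a b) :=
    ((((hx₂.continuousOn.mono hsubI).sub (((huc.mul huc)).div_const _)).add (continuousOn_const.mul hPcont)).add
      (continuousOn_const.mul continuousOn_id))
  have hzd : DifferentiableOn ℝ z (interior (Icc a b)) := by
    rw [interior_Icc]; intro t ht
    have htI : Icc 0 τ ∈ nhds t := Icc_mem_nhds (lt_of_le_of_lt ha ht.1) (lt_of_lt_of_le ht.2 hb)
    have hmem : t ∈ Icc 0 τ := hsubI ⟨ht.1.le, ht.2.le⟩
    have hud : DifferentiableAt ℝ u t := ((hu.differentiableOn one_ne_zero) t hmem).differentiableAt htI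
    have hxd : DifferentiableAt ℝ x₂ t := ((hx₂.differentiableOn one_ne_zero) t hmem).differentiableAt htI
    exact (((hxd.sub ((hud.mul hud).div_const _)).add ((hPderiv t ht).differentiableAt.const_mul _)).add
      ((differentiableAt_id).const_mul _)).differentiableWithinAt
  have hz' : ∀ t ∈ interior (Icc a b), 0 ≤ deriv z t := by
    rw [interior_Icc]; intro t ht
    have htI : Icc 0 τ ∈ nhds t := Icc_mem_nhds (lt_of_le_of_lt ha ht.1) (lt_of_lt_of_le ht.2 hb)
    have hmem : t ∈ Icc 0 τ := hsubI ⟨ht.1.le, ht.2.le⟩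
    have htab : t ∈ Icc a b := ⟨ht.1.le, ht.2.le⟩
    have hud' : DifferentiableWithinAt ℝ u (Icc 0 τ) t := (hu.differentiableOn one_ne_zero) t hmem
    have hxd' : DifferentiableWithinAt ℝ x₂ (Icc 0 τ) t := (hx₂.differentiableOn one_ne_zero) t hmem
    have hua : HasDerivAt u (derivWithin u (Icc 0 τ) t) t := by
      rw [derivWithin_of_mem_nhds htI]; exact (hud'.differentiableAt htI).hasDerivAt
    have hxa : HasDerivAt x₂ (derivWithin x₂ (Icc 0 τ) t) t := by
      rw [derivWithin_of_mem_nhds htI]; exact (hxd'.differentiableAt htI).hasDerivAt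
    have hder : HasDerivAt z (derivWithin x₂ (Icc 0 τ) t -
        (derivWithin u (Icc 0 τ) t * u t + u t * derivWithin u (Icc 0 τ) t) / (2 * M) +
        ε' / M * u t + ε₂ * 1) t :=
      ((hxa.sub ((hua.mul hua).div_const _)).add ((hPderiv t ht).const_mul _)).add ((hasDerivAt_id t).const_mul _)
    rw [hder.deriv]
    have h1 := hu'up t htab; have h2 := hx₂'lo t htab; have h3 := hpos t htab
    have h5 : u t * derivWithin u (Icc 0 τ) t ≤ Λ * M * u t ^ 2 + u t * ε' := by
      have := mul_le_mul_of_nonneg_left h1 h3; nlinarith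
    have e : (derivWithin u (Icc 0 τ) t * u t + u t * derivWithin u (Icc 0 τ) t) / (2 * M) =
        (u t * derivWithin u (Icc 0 τ) t) / M := by field_simp; ring
    rw [e]
    have h6 : u t * derivWithin u (Icc 0 τ) t / M ≤ Λ * u t ^ 2 + ε' / M * u t := by
      rw [div_le_iff₀ hM]
      have : (Λ * u t ^ 2 + ε' / M * u t) * M = Λ * M * u t ^ 2 + u t * ε' := by field_simp
      rw [this]; exact h5
    linarith
  have hmono : MonotoneOn z (Icc a b) := monotoneOn_of_deriv_nonneg (convex_Icc a b) hzc hzd hz'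
  intro t ht
  have h1 := hmono (left_mem_Icc.mpr hab) ht ht.1
  simp only [hz, intervalIntegral.integral_same, mul_zero, add_zero] at h1
  have e1 : u t * u t / (2 * M) - u a * u a / (2 * M) = (u t ^ 2 - u a ^ 2) / (2 * M) := by ring
  linarith


/-! ### The front block on the window -/

variable {τ : ℝ} {α : Fin 4 → Fin 4 → Fin 4 → ℤ × ℤ × ℤ → ℝ}
  {S₀ F₀ B₀ : Fin 4 → ℤ → ℝ} {S F : Fin 4 → ℤ → ℝ → ℝ}

/-- `√F₁₂ ≤ 9.49e-4` at a window time (two-pass slack bound; sharper form of the `window_sqrtF` clause). [this file] -/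
theorem window_sqrtF12 (h : PseudoFlowOn τ 1 α (1 / 10 ^ 8) (1 / 10 ^ 8) S₀ F₀ B₀ S F)
    (hB2 : ∀ i, B₀ i 2 ≤ 9 / 10 ^ 7)
    (hEnv : ∀ s ∈ Icc (0 : ℝ) Tstar, ∀ (i : Fin 4) (k : ℤ), 0 ≤ k → k ≤ 2 → i ≠ 3 → F i k s ≤ relayEnv₂ k)
    (hA : ∀ s ∈ Icc (0 : ℝ) τ, s ≤ 8 → ∀ k : ℤ, -3 ≤ k → ∑ i, F i k s ≤ 5 / 2)
    (hu2P : ∀ s ∈ Icc (0 : ℝ) Tstar, |S 1 2 s| ≤ 1 / 10 ^ 7)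
    {t : ℝ} (htτ : t ≤ τ) (hlen : t - Tstar ≤ 7 / 10)
    (hu2c : ∀ s ∈ Icc Tstar t, S 1 2 s ≤ 102 / 10 ^ 7 ∧ -S 1 2 s ≤ 102 / 10 ^ 10)
    {s : ℝ} (hs : s ∈ Icc Tstar t) : Real.sqrt (F 1 2 s) ≤ 949 / 10 ^ 6 := by
  have hT0 : (0 : ℝ) ≤ Tstar := by unfold Tstar; norm_num
  have hTs : Tstar ≤ s := hs.1
  have hsτ' : s ≤ τ := hs.2.trans htτ
  have hsτ : s ∈ Icc 0 τ := ⟨hT0.trans hTs, hsτ'⟩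
  have hsT' : s - 147 / 64 ≤ 7 / 10 := by unfold Tstar at hlen hs; linarith [hs.2]
  have hT147 : Tstar = 147 / 64 := rfl
  have hκ2 : (0 : ℝ) ≤ 1 / 10 ^ 8 := by norm_num
  have hA' : ∀ r ∈ Icc Tstar s, F 1 2 r ≤ 5 / 2 := by
    intro r hr
    have hrτ : r ∈ Icc 0 τ := ⟨hT0.trans hr.1, hr.2.trans hsτ'⟩
    have h1 : F 1 2 r ≤ ∑ j, F j 2 r :=
      Finset.single_le_sum (f := fun j => F j 2 r) (fun j _ => h.nonneg_F j 2 r hrτ) (Finset.mem_univ 1)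
    have hr8 : r ≤ 8 := by unfold Tstar at hr; linarith [hr.2, hs.2, hlen]
    exact h1.trans (hA r hrτ hr8 2 (by norm_num))
  have hu2sq : ∀ r ∈ Icc Tstar s, S 1 2 r ^ 2 ≤ (102 / 10 ^ 7) ^ 2 := by
    intro r hr
    have hc := hu2c r ⟨hr.1, hr.2.trans hs.2⟩
    nlinarith only [hc.1, hc.2]
  have pass1 : ∀ r ∈ Icc (0 : ℝ) s, F 1 2 r ≤ 137 / 10 ^ 8 := by
    intro r hr
    rcases le_or_gt r Tstar with hrT | hrT
    · have hrT' : r ∈ Icc (0 : ℝ) Tstar := ⟨hr.1, hrT⟩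
      have hrτ : r ∈ Icc 0 τ := ⟨hr.1, hrT.trans (hTs.trans hsτ')⟩
      have h1 := energy_le_slack h hκ2 1 2 hrτ (M := 1 / 2) fun q hq => by
        have := hEnv q ⟨hq.1, hq.2.trans hrT⟩ 1 2 (by norm_num) (by norm_num) (by decide); rwa [relayEnv₂_two] at this
      rw [weight_at_two] at h1
      have hq : S 1 2 r ^ 2 ≤ (1 / 10 ^ 7) ^ 2 := by
        rw [← sq_abs]; exact pow_le_pow_left₀ (abs_nonneg _) (hu2P r hrT') 2
      have hr147 : r ≤ 147 / 64 := hrT.trans (by unfold Tstar; norm_num)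
      linarith only [h1, hq, hr147, hB2 1, hr.1]
    · have hrW : r ∈ Icc Tstar s := ⟨hrT.le, hr.2⟩
      have hrτ' : r ≤ τ := hr.2.trans hsτ'
      have h1 := energy_le_slack₂ h hκ2 1 2 hT0 hrT.le hrτ'
        (fun q hq => (relayEnv₂_two ▸ hEnv q hq 1 2 (by norm_num) (by norm_num) (by decide)))
        (fun q hq => hA' q ⟨hq.1, hq.2.trans hr.2⟩)
      rw [weight_at_two, hT147] at h1
      have hq := hu2sq r hrW
      have hr07 : r - 147 / 64 ≤ 7 / 10 := by linarith [hr.2, hsT']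
      have hr0 : 0 ≤ r - 147 / 64 := by unfold Tstar at hrT; linarith
      linarith only [h1, hq, hr07, hr0, hB2 1]
  have pass2 := energy_le_slack h hκ2 1 2 hsτ (M := 137 / 10 ^ 8) pass1
  rw [weight_at_two] at pass2
  have hs3 : s ≤ 3 := by unfold Tstar at hsT' hTs; linarith
  have hq := hu2sq s ⟨hTs, le_rfl⟩
  have hk : 1 / 10 ^ 8 * 16 * (137 / 10 ^ 8 * s) ≤ 1 / 10 ^ 8 * 16 * (137 / 10 ^ 8 * 3) := by linarith only [hs3]
  exact sqrt_le_of_le_sq (by norm_num) (by linarith only [pass2, hq, hB2 1, hk])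

end Summit.NavierStokesRegularity.NavierStokesRegularity.Cruxes.RelayFrontStep.Window2
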